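import Literature.Computation.KummerOrbifold.Basics
import HarnessLib

/-!
# Kummer orbifold model — sectors, the FG/FTV product, invariant classes

Area `Literature/Computation/KummerOrbifold` (cell `hodge-kum4`, seat p1).  The sector of `g ∈ 𝔖_m` is
`K_P = {b ∈ A^P : Σ_B |B| b_B = 0}`, `P` the orbit partition of `g` (connected iff `gcd(|B|) = 1`;
for `P = [m]` it is the point set `A[m]`); `H*(K_P)` is represented in `∧(V ⊗ ℚ^m)` on the generators
`e_a^{(i)}`, `i = min B` ("rep coordinates"), modulo `Σ_B |B| e_a^{(min B)}`, with reduced normal form =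
eliminate the LAST block; grading `d + 2(m - #blocks)`.  The product is Fantechi–Göttsche's
(Cor. 3.11: for `c(T_A) = 1` the obstruction is the genus-0 rule), twisted by the Fu–Tian–Vial sign
`(-1)^{(l(g)+l(h)-l(gh))/2}` (discrete torsion): `x_g ⋆ y_h = ± ι_*(x|_{M^{⟨g,h⟩}} · y|_{M^{⟨g,h⟩}})` in
`H*(M^{gh})` if all `⟨g,h⟩`-orbits have genus `0`, else `0`; restriction = merging rep coordinates,
Gysin `ι_*` = wedge with the class `D` of `A^{P∨}` in `A^{P(gh)}`.  `𝔖_m` acts by relabelling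
coordinates; an invariant class is a family `g ↦ x_g`, stored either fully (`Cls` over all `g`) or at
the conjugacy-class representatives ("rep dict", centralizer-invariant components).  Conventions and
formulas are those of the cell's census implementation g2 (`census-g2/code/kfg.py`), whose output
this port reproduces exactly (Betti numbers, Fujiki constant `525`, `q(δ) = -10`, term counts).
Definitions only; correctness is certified by computation downstream (`Certificate5`) and by the
printed invariants it reproduces.

Sources: Fu–Tian–Vial, Geom. Topol. 23 (2019) Thm. 1.4/1.5 and §2 (orbifold product, discrete
torsion); Fantechi–Göttsche, Duke Math. J. 117 (2003) §3 (Thm. 3.10, Cor. 3.11).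
-/

set_option autoImplicit false

namespace Literature.Computation.KummerOrbifold

/-! ## Sectors -/


/-- `Sector` (data of the computable orbifold model). [cite: FuTianVial2019, Thm. 1.5 (and Thm. 1.4; the orbifold product of §2 with discrete torsion)] -/
structure Sector where
  m : Nat
  P : Array (Array Nat)      -- blocks
  rep : Array Nat            -- coordinate ↦ rep coordinate (min of its block)
  size : Array Nat           -- coordinate ↦ size of its block (meaningful at reps)
  reps : Array Nat           -- block reps in block order
  elim : Nat                 -- eliminated rep (last block)
  kept : Array Nat
  shift : Nat                -- 2 (m - #blocks)
  redTable : Std.HashMap Nat Ext   -- bit ↦ linear form (for bits of the eliminated rep)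
  elimExp : Array Ext        -- for each 4-bit pattern `me` of eliminated bits: expansion of `∧_{a ∈ me} form_a`
  S : Ext                    -- Π_a (Σ_B |B| e_a^{(rep B)})
  topmask : Nat
  deriving Inhabited

namespace Sector

/-- (plumbing) [cite: FuTianVial2019, Thm. 1.5 (and Thm. 1.4; the orbifold product of §2 with discrete torsion)] -/
def ofPartition (P : Array (Array Nat)) (m : Nat) : Sector := Id.run do
  let mut rep := Array.replicate m 0
  let mut size := Array.replicate m 0
  for B in P do
    for i in B do
      rep := rep.set! i B[0]!
    size := size.set! B[0]! B.size
  let reps := P.map (fun B => B[0]!)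
  let elim := reps[reps.size - 1]!
  let kept := reps.pop
  let shift := 2 * (m - P.size)
  let ne : Rat := (size[elim]! : Rat)
  let mut table : Std.HashMap Nat Ext := Std.HashMap.emptyWithCapacity 8
  for a in [0:4] do
    let mut form : Ext := Ext.mk
    for j in kept do
      form := form.insert (1 <<< (4 * j + a)) (-((size[j]! : Rat) / ne))
    table := table.insert (4 * elim + a) form
  let mut elimExp : Array Ext := #[]
  for me in [0:16] do
    let mut E : Ext := Ext.one
    for a in [0:4] do
      if (me >>> a) &&& 1 == 1 then
        E := Ext.wedge E ((table.get? (4 * elim + a)).getD Ext.mk)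
    elimExp := elimExp.push E
  let mut S : Ext := Ext.one
  for a in [0:4] do
    let mut form : Ext := Ext.mk
    for j in reps do
      form := form.insert (1 <<< (4 * j + a)) (size[j]! : Rat)
    S := Ext.wedge S form
  let topmask := reps.foldl (fun acc j => acc ||| (0b1111 <<< (4 * j))) 0
  return { m := m, P := P, rep := rep, size := size, reps := reps, elim := elim, kept := kept,
           shift := shift, redTable := table, elimExp := elimExp, S := S, topmask := topmask }

/-- reduced normal form: substitute the eliminated block's generators (all kept rep bits are below the
eliminated bits, so `e_m = e_{m_kept} ∧ e_{m_elim}` and we wedge with the precomputed expansion). [cite: FuTianVial2019, Thm. 1.5 (and Thm. 1.4; the orbifold product of §2 with discrete torsion)] -/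
def reduce (sec : Sector) (x : Ext) : Ext :=
  let sh := 4 * sec.elim
  let em := 0b1111 <<< sh
  if x.fold (fun b m _ => b || (m &&& em != 0)) false then
    x.fold (fun (acc : Ext) m c =>
      let me := (m >>> sh) &&& 0b1111
      if me == 0 then acc.addTerm m c else
        let mk := m ^^^ (me <<< sh)
        (sec.elimExp[me]!).fold (fun (acc : Ext) m2 c2 =>
          match Ext.monoSignNeg? mk m2 with
          | none => acc
          | some neg => acc.addTerm (mk ||| m2) (if neg then -(c * c2) else c * c2)) acc) Ext.mk
  else x

/-- `∫_{K_P} x = ∫_{A^P} x ∧ S_P` [cite: FuTianVial2019, Thm. 1.5 (and Thm. 1.4; the orbifold product of §2 with discrete torsion)] -/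
def integral (sec : Sector) (x : Ext) : Rat :=
  ((Ext.wedge x sec.S).get? sec.topmask).getD 0

end Sector

/-- restriction `H*(K_{Pfrom}) → H*(K_{Pto})`, `Pto` coarser: relabel rep coords [cite: FantechiGoettsche2003, §3 (Thm. 3.10, the ring structure; genus/obstruction rule)] -/
def restrictTo (x : Ext) (secto : Sector) : Ext := Ext.relabel x (fun i => secto.rep[i]!)

/-- class of `A^{Pcoarse}` inside `A^{Pfine}` in fine rep coords [cite: FantechiGoettsche2003, §3 (Thm. 3.10, the ring structure; genus/obstruction rule)] -/
def Dclass (seccoarse secfine : Sector) : Ext := Id.run do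
  let mut D := Ext.one
  for C in seccoarse.P do
    let j0 := C[0]!
    let fineReps := ((C.map (fun i => secfine.rep[i]!)).toList.eraseDups).toArray.qsort (· < ·)
    for j in fineReps do
      if j != j0 then
        for a in [0:4] do
          let form := (Ext.single (1 <<< (4 * j + a)) 1).insert (1 <<< (4 * j0 + a)) (-1)
          D := Ext.wedge D form
  return D


/-! ## The model: permutation tables, cached sector products -/


/-- cached data for the product of sectors `(g, h)` [cite: FantechiGoettsche2003, §3 (Thm. 3.10, the ring structure; genus/obstruction rule)] -/
structure ProdData where
  gh : Nat
  secV : Sector      -- sector of the join partition (restriction target)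
  D : Ext            -- Gysin class (join blocks inside P(gh)), in rep coords of P(gh)
  neg : Bool         -- sign (-1)^{(l g + l h - l gh)/2}
  deriving Inhabited

/-- The model: the group `𝔖_m` with its tables, the sectors, class representatives and the cached
sector-product data. [cite: FuTianVial2019, Thm. 1.5 (and Thm. 1.4; the orbifold product of §2 with discrete torsion)] -/
structure Model where
  m : Nat
  G : Array Perm
  idxOf : Std.HashMap Nat Nat     -- code ↦ index
  comp : Array (Array Nat)
  inv : Array Nat
  len : Array Nat                 -- l(g) = m - #orbits
  sec : Array Sector              -- sector of each g (by index)
  ctype : Array (List Nat)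
  reps : Array Nat                -- class representatives (g2's canonical reps), sorted by cycle type
  repOf : Array Nat               -- index ↦ its class rep
  conj : Array Nat                -- conj[g] = σ with σ rep σ⁻¹ = g
  cent : Array (Array Nat)        -- centralizer of each rep (indexed by position in `reps`)
  idIdx : Nat
  pd : Array (Option ProdData)    -- product data, index g * |G| + h (none = killed by the genus rule)

namespace Model

/-- (plumbing) [cite: FuTianVial2019, Thm. 1.5 (and Thm. 1.4; the orbifold product of §2 with discrete torsion)] -/
def build (m : Nat) : Model := Id.run do
  let G : Array Perm := ((permsOf (List.range m)).map List.toArray).toArray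
  let n := G.size
  let mut idxOf : Std.HashMap Nat Nat := Std.HashMap.emptyWithCapacity (2 * n)
  for i in [0:n] do idxOf := idxOf.insert (Perm.code G[i]!) i
  let ix (p : Perm) : Nat := (idxOf.get? (Perm.code p)).getD 0
  let mut comp : Array (Array Nat) := #[]
  for i in [0:n] do
    let mut row : Array Nat := #[]
    for j in [0:n] do row := row.push (ix (Perm.compose G[i]! G[j]!))
    comp := comp.push row
  let inv := G.map (fun g => ix (Perm.inv g))
  let len := G.map Perm.length
  let sec := G.map (fun g => Sector.ofPartition (Perm.orbits g) m)
  let ctype := G.map Perm.cycleType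
  -- canonical reps: cycles on consecutive blocks, decreasing sizes
  let types := (ctype.toList.eraseDups).toArray.qsort (fun a b => decide (a < b))  -- lexicographic on lists
  let repPerm (ct : List Nat) : Perm := Id.run do
    let mut p := Array.range m
    let mut pos := 0
    for c in ct do
      for t in [0:c] do
        p := p.set! (pos + t) (pos + (t + 1) % c)
      pos := pos + c
    return p
  let reps := types.map (fun ct => ix (repPerm ct))
  let mut repOf := Array.replicate n 0
  for i in [0:n] do
    for r in reps do
      if ctype[r]! == ctype[i]! then repOf := repOf.set! i r
  let mut conj := Array.replicate n 0
  let mut found := Array.replicate n false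
  for r in reps do
    for s in [0:n] do
      let g := comp[comp[s]![r]!]![inv[s]!]!
      if !found[g]! then
        found := found.set! g true
        conj := conj.set! g s
  let cent := reps.map (fun r => (Array.range n).filter (fun c => comp[c]![r]! == comp[r]![c]!))
  let idIdx := ix (Array.range m)
  -- cache: sector of a partition (keyed by the partition's canonical code) and D classes
  let pcode (P : Array (Array Nat)) : Nat :=
    -- label each point by its block's min, encode base m
    (List.range m).foldl (fun acc i =>
      let b := (P.findIdx? (fun B => B.contains i)).getD 0
      acc * (m + 1) + (P[b]!)[0]!) 0
  let mut secCache : Std.HashMap Nat Sector := Std.HashMap.emptyWithCapacity 64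
  let mut dCache : Std.HashMap Nat Ext := Std.HashMap.emptyWithCapacity 256
  let mut pd : Array (Option ProdData) := Array.replicate (n * n) none
  for g in [0:n] do
    for h in [0:n] do
      let gh := comp[g]![h]!
      let Pg := (sec[g]!).P
      let Ph := (sec[h]!).P
      let Pgh := (sec[gh]!).P
      let Pv := joinPartitions Pg Ph m
      if Pg.size + Ph.size + Pgh.size == 2 * Pv.size + m then
        let cv := pcode Pv
        let sv := match secCache.get? cv with
          | some sv => sv
          | none => Sector.ofPartition Pv m
        secCache := secCache.insert cv sv
        let dkey := cv * (m + 1) ^ (m + 1) + pcode Pgh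
        let D := match dCache.get? dkey with
          | some D => D
          | none => Dclass sv sec[gh]!
        dCache := dCache.insert dkey D
        let e2 := len[g]! + len[h]! - len[gh]!
        pd := pd.set! (g * n + h) (some { gh := gh, secV := sv, D := D, neg := (e2 / 2) % 2 == 1 })
  return { m := m, G := G, idxOf := idxOf, comp := comp, inv := inv, len := len, sec := sec,
           ctype := ctype, reps := reps, repOf := repOf, conj := conj, cent := cent, idIdx := idIdx, pd := pd }

variable (Mo : Model)

/-- (plumbing) [folklore] -/
def repPos (r : Nat) : Nat := ((Array.range Mo.reps.size).filter (fun i => Mo.reps[i]! == r))[0]!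

/-- `σ_* : H*(M^g) → H*(M^{σ g σ⁻¹})`, in rep coords of the target [cite: FantechiGoettsche2003, §3 (Thm. 3.10, the ring structure; genus/obstruction rule)] -/
def push (s g : Nat) (x : Ext) : Nat × Ext :=
  let g2 := Mo.comp[Mo.comp[s]![g]!]![Mo.inv[s]!]!
  let sec2 := Mo.sec[g2]!
  let sp := Mo.G[s]!
  (g2, Ext.relabel x (fun i => sec2.rep[sp[i]!]!))

/-- FG product of `x` (sector `g`) and `y` (sector `h`): `(gh, z)` with `z` a free form in rep coords
of `P(gh)`; zero if the genus rule fails [cite: FantechiGoettsche2003, §3 (Thm. 3.10, the ring structure; genus/obstruction rule)] -/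
def sectorProduct (g : Nat) (x : Ext) (h : Nat) (y : Ext) : Nat × Ext :=
  let gh := Mo.comp[g]![h]!
  if x.isEmpty || y.isEmpty then (gh, Ext.mk) else
  match Mo.pd[g * Mo.G.size + h]! with
  | none => (gh, Ext.mk)
  | some pdat =>
    let xr := restrictTo x pdat.secV
    if xr.isEmpty then (gh, Ext.mk) else
    let yr := restrictTo y pdat.secV
    if yr.isEmpty then (gh, Ext.mk) else
    let z := Ext.wedge xr yr
    if z.isEmpty then (gh, Ext.mk) else
    let z := Ext.wedge z pdat.D
    (gh, if pdat.neg then Ext.scale z (-1) else z)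

/-! ## invariant classes: full dicts `g ↦ component` and rep dicts -/

/-- `Cls` (plumbing of the computable orbifold model). [folklore] -/
abbrev Cls := Std.HashMap Nat Ext

namespace Cls
/-- (plumbing) [folklore] -/
def mk : Cls := Std.HashMap.emptyWithCapacity 16
/-- (plumbing) [folklore] -/
def addComp (X : Cls) (g : Nat) (x : Ext) (c : Rat := 1) : Cls :=
  if x.isEmpty then X else
  let cur := (X.get? g).getD Ext.mk
  let new := Ext.addInto cur x c
  if new.isEmpty then X.erase g else X.insert g new
/-- (plumbing) [folklore] -/
def add (X Y : Cls) (c : Rat := 1) : Cls := Y.fold (fun acc g y => acc.addComp g y c) X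
/-- (plumbing) [folklore] -/
def nterms (X : Cls) : Nat := X.fold (fun n _ x => n + x.size) 0
end Cls

/-- extend a rep dict (components at class reps, centralizer-invariant) to all sectors [cite: FantechiGoettsche2003, §3 (Thm. 3.10, the ring structure; genus/obstruction rule)] -/
def extend (comps : Cls) : Cls :=
  (Array.range Mo.G.size).foldl (fun (full : Cls) g =>
    let r := Mo.repOf[g]!
    match comps.get? r with
    | none => full
    | some x =>
      let s := Mo.conj[g]!
      let (_, y) := Mo.push s r x
      full.addComp g y) Cls.mk

/-- product of full dicts, computed at the class reps only (result = rep dict) [cite: FantechiGoettsche2003, §3 (Thm. 3.10, the ring structure; genus/obstruction rule)] -/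
def productReps (X Y : Cls) : Cls :=
  X.fold (fun (out : Cls) g x =>
    let ginv := Mo.inv[g]!
    Mo.reps.foldl (fun (out : Cls) k =>
      let h := Mo.comp[ginv]![k]!
      match Y.get? h with
      | none => out
      | some y =>
        let (_, z) := Mo.sectorProduct g x h y
        out.addComp k z) out) Cls.mk

/-- (plumbing) [cite: FantechiGoettsche2003, §3 (Thm. 3.10, the ring structure; genus/obstruction rule)] -/
def productFull (X Y : Cls) : Cls := Mo.extend (Mo.productReps X Y)

/-- reduced rep components (canonical form) [cite: FuTianVial2019, Thm. 1.5 (and Thm. 1.4; the orbifold product of §2 with discrete torsion)] -/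
def reduceReps (X : Cls) : Cls :=
  Mo.reps.foldl (fun (out : Cls) r =>
    match X.get? r with
    | none => out
    | some x => out.addComp r (Mo.sec[r]!.reduce x)) Cls.mk

/-! ## basic classes -/

/-- the untwisted class `Σ_i x^{(i)}` for `x ∈ ∧V` given on coordinate 0 [cite: FuTianVial2019, Thm. 1.5 (and Thm. 1.4; the orbifold product of §2 with discrete torsion)] -/
def Xclass (x2 : Ext) : Cls :=
  let tot := (List.range Mo.m).foldl (fun (tot : Ext) i =>
    Ext.addInto tot (Ext.relabel x2 (fun j => if j == 0 then i else j))) Ext.mk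
  Cls.mk.addComp Mo.idIdx tot

/-- `Δ` = sum over transpositions of the sector unit [cite: FuTianVial2019, Thm. 1.5 (and Thm. 1.4; the orbifold product of §2 with discrete torsion)] -/
def Delta : Cls :=
  (Array.range Mo.G.size).foldl (fun (out : Cls) g =>
    if Mo.ctype[g]! == (2 :: List.replicate (Mo.m - 2) 1) then out.addComp g Ext.one else out) Cls.mk

/-- `e_a e_b` on coordinate 0 [folklore] -/
def e2 (a b : Nat) : Ext := Ext.wedge (Ext.single (1 <<< a) 1) (Ext.single (1 <<< b) 1)
/-- `e_a` on coordinate 0 [folklore] -/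
def e1 (a : Nat) : Ext := Ext.single (1 <<< a) 1

/-- (plumbing) [cite: FuTianVial2019, Thm. 1.5 (and Thm. 1.4; the orbifold product of §2 with discrete torsion)] -/
def integral (X : Cls) : Rat :=
  match X.get? Mo.idIdx with
  | none => 0
  | some x => (Mo.sec[Mo.idIdx]!.integral x) / (Mo.G.size : Rat)


end Model

end Literature.Computation.KummerOrbifold
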